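import Summits.AnomalousDissipation.AnomalousDissipation.Statement
import Literature.Analysis.FunctionSpaces.TorusFluidGlueProofs
import Literature.Analysis.FunctionSpaces.TorusFourierCalculus
import Literature.Analysis.FluidPDE.LinearizedNSTorus
import Literature.Analysis.FluidPDE.AlexakisDoeringInterpolation

/-!
# Steady states with a fixed force: dissipation = work ≤ ‖f‖₂‖U‖₂ (solo soloist, blind mode)

Two elementary facts about smooth steady states `(U, P)` of the forced Navier–Stokes system on `T³`
(`Torus.IsSteadyNSState ν f U P`: `(U·∇)U = νΔU − ∇P + f`, `div U = 0`) that organise the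
steady zeroth law (`SoloBlindSteadyReduction`):

* `dissipation_eq_work`: `ν ‖∇U‖₂² = ∫ ⟪f, U⟫` — the kinetic energy of a time-independent solution
  is constant, and the tree's energy balance (`Torus.IsClassicalNSSolutionOn.energy_balance_holds`,
  Doering–Foias 2002 §2 (2.4)) identifies its derivative `−ν‖∇U‖₂² + ∫⟪f, U⟫`, which must vanish;
  the spectral form `ν (eGradNormSq U).toReal = ∫ ⟪f, U⟫` follows from
  `gradNormSq_eq_toReal_eGradNormSq_holds` (Temam 1979, Ch. II (1.25): the steady energy equation).
* `dissipation_le`: `ν ‖∇U‖₂² ≤ (∫‖f‖² · ∫‖U‖²)^{1/2}` (Cauchy–Schwarz). Consequently a dissipation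
  floor `ε ≤ νⱼ‖∇Uⱼ‖₂²` along a steady family with FIXED `f` is exactly a floor on the force–flow
  alignment `∫⟪f, Uⱼ⟫`, and forces `∫‖Uⱼ‖² ≥ ε² / ∫‖f‖²`: the steady zeroth law is a statement
  about the WEAK limits of bounded-energy steady states not being orthogonal to `f`
  (Doering–Foias 2002, §3: `ε ≤ ‖f‖₂ U`).
[cite: DoeringFoias2002, §2 (2.4) and §3] [cite: Temam1979, Ch. II (1.25)]
-/

open MeasureTheory Filter Topology Set
open scoped ENNReal NNReal InnerProductSpace

noncomputable section

namespace Summit.AnomalousDissipation.AnomalousDissipation.Theorems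

open Literature.Analysis.FunctionSpaces Literature.Analysis.FluidPDE

/-- The physical flat unit torus `T³ = (ℝ/ℤ)³` (local notation). -/
local notation "𝕋³" => UnitAddTorus (Fin 3)
/-- Velocity values on `T³` (local notation). -/
local notation "E³" => EuclideanSpace ℝ (Fin 3)

/-- **Steady energy identity** `ν ‖∇U‖₂² = ∫ ⟪f, U⟫` for a smooth steady state (derivative form of
`‖∇U‖₂²`; Temam 1979 Ch. II (1.25), via the tree's `energy_balance_holds` at constant data and
uniqueness of derivatives). [cite: Temam1979, Ch. II (1.25)] -/
theorem dissipation_eq_work_classical {ν : ℝ} {f U : 𝕋³ → E³} {P : 𝕋³ → ℝ}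
    (h : Torus.IsSteadyNSState ν f U P) :
    ν * Torus.gradNormSq U = ∫ x, ⟪f x, U x⟫_ℝ := by
  have hb := Torus.IsClassicalNSSolutionOn.energy_balance_holds h convex_univ (mem_univ (0 : ℝ))
  have hc : HasDerivWithinAt (fun _ : ℝ => Torus.kineticEnergy U) 0 (univ : Set ℝ) 0 :=
    (hasDerivAt_const (0 : ℝ) (Torus.kineticEnergy U)).hasDerivWithinAt
  have huniq : -ν * Torus.gradNormSq U + ∫ x, ⟪f x, U x⟫_ℝ = 0 :=
    (hasDerivWithinAt_univ.1 hb).unique (hasDerivWithinAt_univ.1 hc)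
  linarith

/-- **Steady energy identity, spectral form** `ν ‖∇U‖₂² = ∫ ⟪f, U⟫` with the summit's spectral
`Torus.eGradNormSq` (`gradNormSq_eq_toReal_eGradNormSq_holds` on the smooth slice).
[cite: Temam1979, Ch. II (1.25)] -/
theorem dissipation_eq_work {ν : ℝ} {f U : 𝕋³ → E³} {P : 𝕋³ → ℝ}
    (h : Torus.IsSteadyNSState ν f U P) :
    ν * (Torus.eGradNormSq U).toReal = ∫ x, ⟪f x, U x⟫_ℝ := by
  have hU : Torus.IsSmooth U :=
    (Torus.IsClassicalNSSolutionOn.smooth_velocity h).isSmooth_slice (mem_univ (0 : ℝ))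
  rw [← Torus.gradNormSq_eq_toReal_eGradNormSq_holds hU]
  exact dissipation_eq_work_classical h

/-- **Dissipation is bounded by force–flow alignment**: for a smooth steady state with smooth
force, `ν ‖∇U‖₂² ≤ √(∫‖f‖² · ∫‖U‖²)` (the identity `dissipation_eq_work` and Cauchy–Schwarz;
Doering–Foias 2002 §3, `ε ≤ ‖f‖₂ U`). [cite: DoeringFoias2002, §3] -/
theorem dissipation_le {ν : ℝ} {f U : 𝕋³ → E³} {P : 𝕋³ → ℝ}
    (h : Torus.IsSteadyNSState ν f U P) (hf : Torus.IsSmooth f) :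
    ν * (Torus.eGradNormSq U).toReal ≤ Real.sqrt ((∫ x, ‖f x‖ ^ 2) * ∫ x, ‖U x‖ ^ 2) := by
  have hU : Torus.IsSmooth U :=
    (Torus.IsClassicalNSSolutionOn.smooth_velocity h).isSmooth_slice (mem_univ (0 : ℝ))
  rw [dissipation_eq_work h]
  have hfc : Continuous f := hf.continuous
  have hUc : Continuous U := hU.continuous
  have hGc : Continuous fun x => |⟪f x, U x⟫_ℝ| := (hfc.inner hUc).abs
  have hint : Integrable (fun x => ⟪f x, U x⟫_ℝ) volume :=
    (hfc.inner hUc).integrable_of_hasCompactSupport (HasCompactSupport.of_compactSpace _)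
  have hE : Integrable (fun x => ‖f x‖ ^ 2) volume :=
    (hfc.norm.pow 2).integrable_of_hasCompactSupport (HasCompactSupport.of_compactSpace _)
  have hL : Integrable (fun x => ‖U x‖ ^ 2) volume :=
    (hUc.norm.pow 2).integrable_of_hasCompactSupport (HasCompactSupport.of_compactSpace _)
  calc ∫ x, ⟪f x, U x⟫_ℝ ≤ ∫ x, |⟪f x, U x⟫_ℝ| := integral_mono hint hint.abs fun x => le_abs_self _
    _ ≤ Real.sqrt ((∫ x, ‖f x‖ ^ 2) * ∫ x, ‖U x‖ ^ 2) := by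
        refine integral_le_sqrt_integral_mul_integral (ae_of_all _ fun x => abs_nonneg _)
          (ae_of_all _ fun x => sq_nonneg _) (ae_of_all _ fun x => sq_nonneg _)
          (ae_of_all _ fun x => ?_) hGc.aestronglyMeasurable hE hL
        rw [← mul_pow]
        exact pow_le_pow_left₀ (abs_nonneg _) (abs_real_inner_le_norm (f x) (U x)) 2

/-- **Energy floor forced by a dissipation floor**: if `ε ≤ ν ‖∇U‖₂²` for a smooth steady state
with smooth force, then `ε² ≤ ∫‖f‖² · ∫‖U‖²` (square `dissipation_le`). [folklore] -/
theorem energy_floor_of_dissipation_floor {ν ε : ℝ} {f U : 𝕋³ → E³} {P : 𝕋³ → ℝ}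
    (h : Torus.IsSteadyNSState ν f U P) (hf : Torus.IsSmooth f) (hε : 0 ≤ ε)
    (hεU : ε ≤ ν * (Torus.eGradNormSq U).toReal) :
    ε ^ 2 ≤ (∫ x, ‖f x‖ ^ 2) * ∫ x, ‖U x‖ ^ 2 := by
  have h1 := hεU.trans (dissipation_le h hf)
  have hnn : 0 ≤ (∫ x, ‖f x‖ ^ 2) * ∫ x, ‖U x‖ ^ 2 :=
    mul_nonneg (integral_nonneg fun _ => sq_nonneg _) (integral_nonneg fun _ => sq_nonneg _)
  calc ε ^ 2 ≤ (Real.sqrt ((∫ x, ‖f x‖ ^ 2) * ∫ x, ‖U x‖ ^ 2)) ^ 2 :=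
        pow_le_pow_left₀ hε h1 2
    _ = (∫ x, ‖f x‖ ^ 2) * ∫ x, ‖U x‖ ^ 2 := Real.sq_sqrt hnn

end Summit.AnomalousDissipation.AnomalousDissipation.Theorems

end
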